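import Literature.NumberTheory.Sieve.ParityBatemanHorn
import Literature.NumberTheory.Sieve.LinearEquationsInPrimes
import Literature.NumberTheory.Sieve.AletheiaZomleferFukshanskyGarcia2020
import HarnessLib
import HarnessLib.Audit
import HarnessLib.Audit.TribunalTags

/-!
# Strong-Hypothesis Library — summit `Parity` (D-0034, skeleton)

The REGISTRY of known strong hypotheses `H` (open statements with `H ⇒ P` landed or printed) and of
known EQUIVALENT REFORMULATIONS `E` (`E ↔ P` landed or printed) for the two problems of the summit
`Parity := BatemanHorn ∧ GeneralizedHardyLittlewood` (`Summits/Parity/Statement.lean`):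

* `BatemanHorn` (`Summits/Parity/BatemanHorn/Statement.lean`,
  `abbrev BatemanHorn : Prop := Literature.NumberTheory.Sieve.BatemanHornConjecture`; tag key
  `"Parity.BatemanHorn"`): for irreducible `f₁, …, f_k ∈ ℤ[X]` with positive leading coefficients,
  pairwise non-associated, `∏ fᵢ` without fixed prime divisor,
  `#{n ≤ x : all fᵢ(n) prime} ∼ C(f)/(∏ deg fᵢ) · x/(log x)^k` (Bateman–Horn 1962, (1)).
* `GeneralizedHardyLittlewood` (`Summits/Parity/GeneralizedHardyLittlewood/Statement.lean`,
  `abbrev GeneralizedHardyLittlewood : Prop := Literature.NumberTheory.Sieve.GeneralizedHardyLittlewood`;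
  tag key `"Parity.GeneralizedHardyLittlewood"`): Green–Tao 2010, Conjecture 1.2, ALL complexities —
  uniformly over non-degenerate affine-linear systems `Ψ : ℤ^d → ℤ^t` of size `≤ L` and convex
  `K ⊆ [−N, N]^d`, `∑_{n ∈ K ∩ ℤ^d} ∏ᵢ Λ(ψᵢ(n)) = β_∞ ∏_p β_p + o(N^d)`.

Every entry carries `@[strong_hypothesis "Parity.<P>"]`; the kernel tribunal (`#h21_tribunal`, D-0033
T1 rule (a)) probes each registered `H` against a route crux `C` for `H → C`. Bridges live summit-side
in `Summits/Parity/StrongHypotheses.lean`.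

## The honest shape of this summit's library

Both problems are BINARY (infinite-complexity) prime-pattern asymptotics. The parity phenomenon
(Selberg; Bombieri 1976, `Literature.Barriers.Parity.SelbergParity`, `….BombieriAsymptoticSieve*`)
is exactly the statement that the famous DISTRIBUTIONAL hypotheses of the area — Elliott–Halberstam,
generalized Elliott–Halberstam, Chowla, Sarnak, GRH — are NOT known to imply either problem (they
give bounded gaps, almost-primes, averaged forms). Consequently no CLOSED `Prop` of `lean/Literature`
is known, in print or in tree, to imply `BatemanHorn` or `GeneralizedHardyLittlewood`, and this
Literature-side file registers NOTHING by attribute and states NO new conjecture (skeleton scope: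
new decls only when a famous, printed-stronger hypothesis is trivially typeable — none is; see
"Candidates"). All registrations of this summit are SUMMIT-SIDE closed `Prop`s (equivalent criteria
and power-saving strengthenings written by crux strategists in `Summits/Parity/**/{Cruxes,Theorems}`),
tagged in `Summits/Parity/StrongHypotheses.lean` because Literature cannot import `Summits.*`.

## Census

| # | `H` / `E` | one-line statement | relation | source | status here | bridge |
|---|---|---|---|---|---|---|
| 1 | `Summit.Parity.GeneralizedHardyLittlewood.GeneralizedHardyLittlewoodDimOne` | the `d = 1` case of GT Conj. 1.2: Dickson–Hardy–Littlewood `t`-tuples `aᵢ n + bᵢ` with `Λ`-weights, uniform in `‖Ψ‖_N ≤ L` and convex `K ⊆ [−N,N]` | equivalent to GHL | Green–Tao 2010, Conj. 1.2 and the fibration remark of §1 ("holding `d − 1` variables fixed") | registered (summit file; `Theorems/GeneralizedHardyLittlewoodDimOne.lean`, `@[conjecture]`) | landed: `Summit.Parity.GeneralizedHardyLittlewood.generalizedHardyLittlewood_iff_generalizedHardyLittlewoodDimOne` |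
| 2 | `Summit.Parity.GeneralizedHardyLittlewood.Cruxes.DimOne.BirthSieve.TwoFlatFactorsCore` | admissible (`β_p > 0` at every `p`), `t ≥ 2`, rough-vs-rough form of row 1: `|∑_{#T ≥ 2} corrTerm T Ψ K N| ≤ εN` uniformly | equivalent to GHL | Green–Tao 2010, Conj. 1.2 with §12 (12.3); in-tree peel `Theorems/DicksonFibrationDimOne{Defs,Core,Perimeter}.lean` | registered (summit file; `Theorems/DicksonFibrationDimOneDefs.lean`) | landed: `twoFlatFactorsCore_iff_generalizedHardyLittlewoodDimOne` ∘ row 1 |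
| 3 | `Summit.Parity.GeneralizedHardyLittlewood.Cruxes.DimOne.Strategist.PowerSavingDimOne` | row 1 with a POWER SAVING: for every `t, L` some `δ > 0` with error `≤ N^{1−δ}` uniformly | strictly stronger than GHL | [folklore] strengthening `S⁺` of the crux strategist (`Cruxes/DimOne/StrategistSketch.lean`); the square-root-error form of prime-tuple conjectures is standard (Montgomery–Soundararajan-type hypotheses) | registered (summit file) | landed: `dimOne_of_powerSavingDimOne` then `Theses.DicksonFibration.Assembly_holds` |
| 4 | `Summit.Parity.BatemanHorn.Theorems.PolyMobiusTail.Negative.LambdaBatemanHorn` | `Λ`-form of Bateman–Horn for every system: `∑_{n ≤ x} ∏ᵢ Λ(fᵢ(n)) ∼ C(f)·x` | equivalent to BH | Bateman–Horn 1962 (1)–(2) by partial summation; in tree `lambdaToCount_proof` (Λ ⇒ count) and `lambda_isEquivalent_of_batemanHornAsymptotic` (count ⇒ Λ) | registered (summit file; `Theorems/PolyMobiusTail/Negative/Equivalence.lean`) | landed: composed in the summit file (`lambdaBatemanHorn_iff_batemanHorn`) |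
| 5 | `Summit.Parity.BatemanHorn.Cruxes.PolyMobiusTail.StrategyCensus.PolyMobiusTailPowerSaving` | power-saving Möbius-tail cancellation for every BH system: the large-divisor tail of `∑ ∏(μ·log ∗ 1)(fᵢ(n))` is `O(x^{1−δ})` | strictly stronger than BH | [folklore]; the shape of the function-field theorems of Sawin–Shusterman 2022 (Thm 1.2/1.3 over `𝔽_q[u]`), posed over `ℤ` by the crux strategist | registered (summit file) | landed: `polyMobiusTail_of_powerSaving` then `batemanHorn_of_polyMobiusTail` (`StrategyCensus.lean`) |
| 6 | Bateman–Horn with the logarithmic-integral main term `Q(f; x) ∼ C/(∏ deg fᵢ) · ∫₂ˣ dt/(log t)^k` | the conjecture as printed in AZFG 2020 (3.6.2) | equivalent to BH | Aletheia-Zomlefer–Fukshansky–Garcia 2020, §3.6 and Lemma 2.3.2 | not a decl BY DESIGN: the closure `∀ f, BatemanHornAsymptoticLi f` is deliberately not named in `AletheiaZomleferFukshanskyGarcia2020.lean` ("not restated as a second `Prop`"); the equivalence is the LANDED theorem `Literature.NumberTheory.Sieve.batemanHornConjecture_iff_li` (with `LFunctions.isEquivalent_offsetLogIntegralPow_holds`)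 | landed as a theorem, nothing to tag |
| 7 | Bateman–Horn / Schinzel (H) with singular-series asymptotic for polynomial systems in SEVERAL variables (contains BH as `d = 1` and GHL as the affine-linear case) | `#{n ∈ K ∩ ℤ^d : all Fᵢ(n) prime} ∼ 𝔖(F) · ∫_K ∏ dt/log Fᵢ` | strictly stronger than `Parity` (both problems) | qualitative form: Bodin–Dèbes–Najib 2020 ("Schinzel hypothesis for polynomials in several variables"); quantitative multivariable heuristics: Bateman–Horn 1962 §"heuristic", AZFG 2020 §3 | candidate (not yet in tree): typeable (`MvPolynomial (Fin d) ℤ`, `vonMangoldt`, the local factors of `LinearEquationsInPrimes`), but > 15 lines and no single printed statement with a fixed normalisation to transcribe — not stated in the skeleton | none (the specialisations `d = 1` / linear would be routine but no decl exists) |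
| 8 | Friedlander–Iwaniec asymptotic sieve for primes, hypotheses (R), (B) for the sequences sifted by a BH system | `A.FIAsymptoticSieveHypotheses D δ Δ H` for `a_ℓ = #{n ≤ x : f₁(n) = ℓ, f₂(n), …, f_k(n) prime}` | would give BH by induction on `k` (FI 1998 Thm 1: hypotheses ⇒ `∑ a_p log p ∼ H·A(x)`) | Friedlander–Iwaniec, Ann. of Math. 148 (1998), Thm 1 (`Literature.NumberTheory.Sieve.AsymptoticSieveForPrimes`, `fi_asymptotic_sieve_primes_loglog`) | not typeable as ONE closed `Prop` without new bookkeeping (PARAMETRISED by the sequence and by `D, δ, Δ, H`; the closure over BH-sifted sequences and the induction are not in print) | none |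

## Deliberately NOT registered (and why)

* WEAKER than the problems (consequences, most with landed implications FROM `BatemanHorn` /
  `GeneralizedHardyLittlewood`): `Literature.NumberTheory.Sieve.SchinzelHypothesisH`, `DicksonConjecture`,
  `BunyakovskyConjecture`, `TwinPrimeConjecture`, `LandauConjecture`, `HardyLittlewoodConjE`,
  `HardyLittlewoodConjF`, `HardyLittlewoodTuples`, `HardyLittlewoodTuplesLi`, `HardyLittlewoodGoldbach`,
  `GeneralizedHardyLittlewoodCount` (GT Conj. 1.4, count form), `GreenTaoZiegler2012_finiteComplexity`
  (a theorem), `Summit.Parity.BatemanHorn.HardyLittlewoodConjE`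
  (`dicksonConjecture_of_batemanHornConjecture`, `hardyLittlewoodConjE_of_batemanHorn_holds`,
  `twinPrimeConjecture_of_batemanHorn`, `greenTao_of_batemanHorn`,
  `hardyLittlewoodTuples_of_generalizedHardyLittlewoodDimOne`, …). Printed relations kept as facts, never
  as bridges: BH ⇒ Schinzel H ⇒ Dickson, Bunyakovsky; HL `k`-tuples = the translation slice of GHL(`d = 1`).
* NOT KNOWN TO IMPLY either problem (parity barrier; `Literature.Barriers.Parity.SelbergParity`,
  `Literature.NumberTheory.Sieve.bombieri_asymptotic_sieve_indeterminacy`): `ElliottHalberstamConjecture`,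
  `EH θ`, `LevelOfDistribution.ElliottHalberstam`, `GeneralizedElliottHalberstam θ` (GEH ⇒ `H₁ ≤ 6`,
  Polymath 8b, not twin primes), `MPZ ϖ δ`, `ChowlaConjecture`, `MoebiusChowlaConjecture`, `SarnakConjecture`,
  `OddOrderChowla k`, GRH-type hypotheses. Registering any of them would mis-teach the tribunal.
* ONE-POLYNOMIAL / TRANSLATION-ONLY uniformities: `Literature.Barriers.Parity.GranvilleUniformityConjecture`
  (uniform Hypothesis H for ONE irreducible `f` of degree `d` in `x ≥ h(f)^η`; implies only the `k = 1`
  slice of BH — the several-polynomial version is not transcribed in the tree);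
  `Literature.Barriers.Parity.UniformHypothesisHLogPower d B` (parametrised AND refuted in its range:
  `UniformBatemanHornBarrier`, Friedlander–Granville); a Montgomery–Soundararajan-type uniform
  power-saving Hardy–Littlewood TUPLES conjecture (translations `n + hᵢ` only) implies
  `HardyLittlewoodTuples`, not GHL (`d = 1` GHL has arbitrary leading coefficients `aᵢ`: Sophie Germain,
  Goldbach-in-the-shift), and is not in the tree.
* INCOMPATIBLE with the problems (would make probes vacuous if ever combined):
  `Literature.Barriers.Parity.SecondHardyLittlewoodConjecture` (`π(x+y) ≤ π(x) + π(y)`; Hensley–Richards 1974: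
  inconsistent with prime `k`-tuples), `Literature.Barriers.Parity.UnboundedSiegelZeros` (refutes GHL modulo
  Matomäki–Merikoski 2023 Thm 1.3, in tree `not_generalizedHardyLittlewoodDimOne_of_unboundedSiegelZeros`).
* ROUTE CRUXES (`Theses` decls such as `Theses.DicksonFibration.DimOne`, `Theses.IsogenyRedei.PolyMobiusTail`,
  `Theses.LiouvilleShiftedTables.PairsToGHL`) — even those PROVED equivalent to a problem
  (`polyMobiusTail_iff_batemanHorn`, `dimOne_iff_ghl`) — are what the tribunal probes; never tagged.

## Not yet typeable

* Row 7 (multivariable Bateman–Horn) is typeable in principle; what is missing is a printed statement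
  with fixed normalisation (real density `∫_K ∏ 1/log Fᵢ` vs. `vol K/(log N)^t`, ordering of the Euler
  product) — a Literature entry of its own, not a skeleton item.
* Row 8 needs a "sequence sifted by a polynomial system" constructor into
  `Literature.NumberTheory.Sieve.SieveSequence` / the FI hypothesis structure and the induction on `k`;
  none of it is in print as a single hypothesis.

## Sources (keys in `lean/references.bib`)

[BatemanHornMathComp1962] (1)–(2); [GreenTao2010] Def. 1.1, Conj. 1.2, Conj. 1.4, §1 (fibration remark),
§12 (12.3); [AletheiaZomleferFukshanskyGarcia2020] §2.3 Lemma 2.3.2, §3.6 (3.6.1)–(3.6.3);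
[SawinShusterman2022] Thm 1.2/1.3; [FriedlanderIwaniecASP1998] Thm 1; [Bombieri1976]; [Polymath8b2014];
[Granville1995Irregularities] Conjecture; [FriedlanderGranville1991]; [BodinDebesNajib2020];
[SchinzelSierpinski1958]; [Dickson1904]; [HardyLittlewood1923] Conj. B; [MatomakiMerikoski2023] Thm 1.3.
-/

/-! ## Existing Literature conjecture `def`s tagged in place: NONE (see the module docstring) -/

namespace Literature.StrongHypotheses.Parity

end Literature.StrongHypotheses.Parity
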